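import Summits.AtomisticToContinuum.Crystallization.Theorems.HullExactificationCascadeZeroDefectDensityLocalStructureFrame
import HarnessLib

/-!
# Local structure of a soft twelve-shell — part 2/6: frame windows of shell points
# (route `HullExactificationCascade`, crux `ZeroDefectDensity`, stmt-AtomisticToContinuum-12086;
# line `birth`, stub `stub_localStructure`)

Support file (lead c5, stub-worker K3), continuing `…LocalStructureFrame` (frame functions
`R, P, D, S` with their defining equations `hF`, and `orient3`, as there): the metric hypotheses
of the stub (radii `dist u V`, `dist u X` and contacts `dist V X` in `[1 - 1/4000, 1 + 1/4000]`)
turned into frame data.  A contact `X` of the shell point `V` (axis `c = u - V`, `x = X - V`) has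
`⟪c, x⟫ ∈ [0.49924, 0.50076]` and
`R ∈ [0.7482, 0.7518]` (`rot_vpoint`); a contact pair of contacts has `D ∈ [0.329, 0.338]`
(`rot_vcontact`), any pair `D ≤ 0.338` (`rot_vany`), a non-contact pair (`≥ 7/5`) `D ≤ -0.30`
(`rot_vfar`); conversely `D ∈ [-0.40, -0.30]` gives `d² ∈ [1.94, 2.11]` (`rot_vlarge`) and
`D ≤ -0.77` gives `d² ≥ 2.6` (`rot_vdiag`); a contact pair has `T ≠ 0` (`rot_vT_ne_zero`).

Mathlib + part 1 only; no named fact is used. [folklore]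
-/

noncomputable section

namespace Summit.AtomisticToContinuum.Crystallization.Theorems.ZeroDefectDensityBirth

open scoped RealInnerProductSpace
open Literature.Geometry.DiscreteGeometry

variable {R : EuclideanSpace ℝ (Fin 3) → EuclideanSpace ℝ (Fin 3) → ℝ}
  {P D S : EuclideanSpace ℝ (Fin 3) → EuclideanSpace ℝ (Fin 3) → EuclideanSpace ℝ (Fin 3) → ℝ}
  (hF : (∀ c x, R c x = ‖c‖ ^ 2 * ‖x‖ ^ 2 - ⟪c, x⟫ ^ 2) ∧
    (∀ c x y, P c x y = ‖c‖ ^ 2 * ⟪x, y⟫ - ⟪c, x⟫ * ⟪c, y⟫) ∧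
    (∀ c x y, D c x y = P c x y / (√(R c x) * √(R c y))) ∧
    (∀ c x y, S c x y = ‖c‖ * orient3 c x y / (√(R c x) * √(R c y))))
include hF

/-! ## Windows for shell points -/

/-- **A contact in the frame.**  `V` a shell point with axis `c = u - V`, `X` a soft contact of `V`
on the shell, `x = X - V`: `⟪c, x⟫ ∈ [0.49924, 0.50076]`, `R ∈ [0.7482, 0.7518]` (so `R > 0`),
`‖x‖² ∈ [0.9995, 1.0005001]`, `‖c‖², likewise`, `c ≠ 0`. [folklore] -/
theorem rot_vpoint {u V X : EuclideanSpace ℝ (Fin 3)}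
    (hV : 1 - 1 / 4000 ≤ dist u V ∧ dist u V ≤ 1 + 1 / 4000)
    (hX : 1 - 1 / 4000 ≤ dist u X ∧ dist u X ≤ 1 + 1 / 4000)
    (hVX : 1 - 1 / 4000 ≤ dist V X ∧ dist V X ≤ 1 + 1 / 4000) :
    (0.49924 ≤ ⟪u - V, X - V⟫ ∧ ⟪u - V, X - V⟫ ≤ 0.50076 ∧ 0.7482 ≤ R (u - V) (X - V) ∧
      R (u - V) (X - V) ≤ 0.7518 ∧ 0 < R (u - V) (X - V)) ∧
      (0.9995 ≤ ‖X - V‖ ^ 2 ∧ ‖X - V‖ ^ 2 ≤ 1.0005001) ∧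
      (0.9995 ≤ ‖u - V‖ ^ 2 ∧ ‖u - V‖ ^ 2 ≤ 1.0005001 ∧ 0 < ‖u - V‖ ∧ u - V ≠ 0) := by
  rw [dist_eq_norm] at hV
  rw [dist_comm, dist_eq_norm, ← sub_sub_sub_cancel_right X u V] at hX
  rw [dist_comm, dist_eq_norm] at hVX
  obtain ⟨hA, hA', hA0⟩ := rot_band hV.1 hV.2
  obtain ⟨hB, hB', -⟩ := rot_band hVX.1 hVX.2
  obtain ⟨hD, hD', -⟩ := rot_band hX.1 hX.2
  have hg : 2 * ⟪u - V, X - V⟫ = ‖u - V‖ ^ 2 + ‖X - V‖ ^ 2 - ‖X - V - (u - V)‖ ^ 2 := by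
    rw [norm_sub_sq_real (X - V) (u - V), real_inner_comm]
    ring
  obtain ⟨h1, h2, h3, h4⟩ := rot_point hA hA' hB hB' hD hD' hg (hF.1 _ _)
  exact ⟨⟨h1, h2, h3, h4, by linarith⟩, ⟨hB, hB'⟩, ⟨hA, hA', hA0, norm_pos_iff.mp hA0⟩⟩

/-- **A contact pair in the frame**: `0.329 ≤ D ≤ 0.338`. [folklore] -/
theorem rot_vcontact {u V X Y : EuclideanSpace ℝ (Fin 3)}
    (hV : 1 - 1 / 4000 ≤ dist u V ∧ dist u V ≤ 1 + 1 / 4000)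
    (hX : 1 - 1 / 4000 ≤ dist u X ∧ dist u X ≤ 1 + 1 / 4000)
    (hVX : 1 - 1 / 4000 ≤ dist V X ∧ dist V X ≤ 1 + 1 / 4000)
    (hY : 1 - 1 / 4000 ≤ dist u Y ∧ dist u Y ≤ 1 + 1 / 4000)
    (hVY : 1 - 1 / 4000 ≤ dist V Y ∧ dist V Y ≤ 1 + 1 / 4000)
    (hXY : 1 - 1 / 4000 ≤ dist X Y ∧ dist X Y ≤ 1 + 1 / 4000) :
    0.329 ≤ D (u - V) (X - V) (Y - V) ∧ D (u - V) (X - V) (Y - V) ≤ 0.338 := by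
  obtain ⟨⟨gx, gx', Rx, Rx', Rx0⟩, ⟨Bx, Bx'⟩, ⟨hA, hA', -, -⟩⟩ := rot_vpoint hF hV hX hVX
  obtain ⟨⟨gy, gy', Ry, Ry', Ry0⟩, ⟨By, By'⟩, -⟩ := rot_vpoint hF hV hY hVY
  rw [dist_eq_norm, ← sub_sub_sub_cancel_right X Y V] at hXY
  obtain ⟨hD, hD', -⟩ := rot_band hXY.1 hXY.2
  have hg : 2 * ⟪X - V, Y - V⟫ = ‖X - V‖ ^ 2 + ‖Y - V‖ ^ 2 - ‖X - V - (Y - V)‖ ^ 2 := by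
    rw [norm_sub_sq_real (X - V) (Y - V)]
    ring
  obtain ⟨P1, P2⟩ := rot_Pcontact (gxy := ⟪X - V, Y - V⟫) hA hA' gx gx' gy gy' (by linarith)
    (by linarith)
  obtain ⟨sx, sx'⟩ := rot_sqrtR Rx Rx'
  obtain ⟨sy, sy'⟩ := rot_sqrtR Ry Ry'
  obtain ⟨st, st'⟩ := rot_prodR sx sx' sy sy'
  rw [le_rotD_iff hF Rx0 Ry0, rotD_le_iff hF Rx0 Ry0]
  constructor <;> nlinarith

/-- **Any two shell contacts of `V`** (chord `≥ 1 - 1/4000`): `D ≤ 0.338`. [folklore] -/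
theorem rot_vany {u V X Y : EuclideanSpace ℝ (Fin 3)}
    (hV : 1 - 1 / 4000 ≤ dist u V ∧ dist u V ≤ 1 + 1 / 4000)
    (hX : 1 - 1 / 4000 ≤ dist u X ∧ dist u X ≤ 1 + 1 / 4000)
    (hVX : 1 - 1 / 4000 ≤ dist V X ∧ dist V X ≤ 1 + 1 / 4000)
    (hY : 1 - 1 / 4000 ≤ dist u Y ∧ dist u Y ≤ 1 + 1 / 4000)
    (hVY : 1 - 1 / 4000 ≤ dist V Y ∧ dist V Y ≤ 1 + 1 / 4000)
    (hXY : 1 - 1 / 4000 ≤ dist X Y) : D (u - V) (X - V) (Y - V) ≤ 0.338 := by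
  obtain ⟨⟨gx, -, Rx, Rx', Rx0⟩, ⟨-, Bx'⟩, ⟨hA, hA', -, -⟩⟩ := rot_vpoint hF hV hX hVX
  obtain ⟨⟨gy, -, Ry, Ry', Ry0⟩, ⟨-, By'⟩, -⟩ := rot_vpoint hF hV hY hVY
  rw [dist_eq_norm, ← sub_sub_sub_cancel_right X Y V] at hXY
  have hD : 0.9995 ≤ ‖X - V - (Y - V)‖ ^ 2 := by nlinarith
  have hg : 2 * ⟪X - V, Y - V⟫ = ‖X - V‖ ^ 2 + ‖Y - V‖ ^ 2 - ‖X - V - (Y - V)‖ ^ 2 := by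
    rw [norm_sub_sq_real (X - V) (Y - V)]
    ring
  have P2 := rot_Pupper hA hA' gx gy (by norm_num : (0:ℝ) ≤ 0.50076) (by linarith)
  obtain ⟨sx, sx'⟩ := rot_sqrtR Rx Rx'
  obtain ⟨sy, sy'⟩ := rot_sqrtR Ry Ry'
  obtain ⟨st, st'⟩ := rot_prodR sx sx' sy sy'
  rw [rotD_le_iff hF Rx0 Ry0]
  nlinarith

/-- **A non-contact pair of contacts of `V`** (chord `≥ 7/5`): `D ≤ -0.30`. [folklore] -/
theorem rot_vfar {u V X Y : EuclideanSpace ℝ (Fin 3)}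
    (hV : 1 - 1 / 4000 ≤ dist u V ∧ dist u V ≤ 1 + 1 / 4000)
    (hX : 1 - 1 / 4000 ≤ dist u X ∧ dist u X ≤ 1 + 1 / 4000)
    (hVX : 1 - 1 / 4000 ≤ dist V X ∧ dist V X ≤ 1 + 1 / 4000)
    (hY : 1 - 1 / 4000 ≤ dist u Y ∧ dist u Y ≤ 1 + 1 / 4000)
    (hVY : 1 - 1 / 4000 ≤ dist V Y ∧ dist V Y ≤ 1 + 1 / 4000)
    (hXY : 7 / 5 ≤ dist X Y) : D (u - V) (X - V) (Y - V) ≤ -0.30 := by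
  obtain ⟨⟨gx, -, Rx, Rx', Rx0⟩, ⟨-, Bx'⟩, ⟨hA, hA', -, -⟩⟩ := rot_vpoint hF hV hX hVX
  obtain ⟨⟨gy, -, Ry, Ry', Ry0⟩, ⟨-, By'⟩, -⟩ := rot_vpoint hF hV hY hVY
  rw [dist_eq_norm, ← sub_sub_sub_cancel_right X Y V] at hXY
  have hD : 49 / 25 ≤ ‖X - V - (Y - V)‖ ^ 2 := by nlinarith
  have hg : 2 * ⟪X - V, Y - V⟫ = ‖X - V‖ ^ 2 + ‖Y - V‖ ^ 2 - ‖X - V - (Y - V)‖ ^ 2 := by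
    rw [norm_sub_sq_real (X - V) (Y - V)]
    ring
  have P2 := rot_Pupper hA hA' gx gy (by norm_num : (0:ℝ) ≤ 0.0205001) (by linarith)
  obtain ⟨sx, sx'⟩ := rot_sqrtR Rx Rx'
  obtain ⟨sy, sy'⟩ := rot_sqrtR Ry Ry'
  obtain ⟨st, st'⟩ := rot_prodR sx sx' sy sy'
  rw [rotD_le_iff hF Rx0 Ry0]
  nlinarith

/-- **Large corner, back to the chord**: `D ∈ [-0.40, -0.30]` gives `d² ∈ [1.94, 2.11]`.
[folklore] -/
theorem rot_vlarge {u V X Y : EuclideanSpace ℝ (Fin 3)}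
    (hV : 1 - 1 / 4000 ≤ dist u V ∧ dist u V ≤ 1 + 1 / 4000)
    (hX : 1 - 1 / 4000 ≤ dist u X ∧ dist u X ≤ 1 + 1 / 4000)
    (hVX : 1 - 1 / 4000 ≤ dist V X ∧ dist V X ≤ 1 + 1 / 4000)
    (hY : 1 - 1 / 4000 ≤ dist u Y ∧ dist u Y ≤ 1 + 1 / 4000)
    (hVY : 1 - 1 / 4000 ≤ dist V Y ∧ dist V Y ≤ 1 + 1 / 4000)
    (hD1 : -0.40 ≤ D (u - V) (X - V) (Y - V)) (hD2 : D (u - V) (X - V) (Y - V) ≤ -0.30) :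
    1.94 ≤ dist X Y ^ 2 ∧ dist X Y ^ 2 ≤ 2.11 := by
  obtain ⟨⟨gx, gx', Rx, Rx', Rx0⟩, ⟨Bx, Bx'⟩, ⟨hA, -, -, -⟩⟩ := rot_vpoint hF hV hX hVX
  obtain ⟨⟨gy, gy', Ry, Ry', Ry0⟩, ⟨By, By'⟩, -⟩ := rot_vpoint hF hV hY hVY
  rw [dist_eq_norm, ← sub_sub_sub_cancel_right X Y V]
  have hg : ‖X - V - (Y - V)‖ ^ 2 = ‖X - V‖ ^ 2 + ‖Y - V‖ ^ 2 - 2 * ⟪X - V, Y - V⟫ := by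
    rw [norm_sub_sq_real (X - V) (Y - V)]
    ring
  obtain ⟨sx, sx'⟩ := rot_sqrtR Rx Rx'
  obtain ⟨sy, sy'⟩ := rot_sqrtR Ry Ry'
  obtain ⟨st, st'⟩ := rot_prodR sx sx' sy sy'
  have hP : ‖u - V‖ ^ 2 * ⟪X - V, Y - V⟫ - ⟪u - V, X - V⟫ * ⟪u - V, Y - V⟫ =
      D (u - V) (X - V) (Y - V) * (√(R (u - V) (X - V)) * √(R (u - V) (Y - V))) :=
    (rotD_mul hF Rx0 Ry0).symm
  rw [hg]
  exact rot_chord_large hA Bx Bx' By By' gx gx' gy gy' st st' hP hD1 hD2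

/-- **Diagonal, back to the chord**: `D ≤ -0.77` gives `d² ≥ 2.6`. [folklore] -/
theorem rot_vdiag {u V X Y : EuclideanSpace ℝ (Fin 3)}
    (hV : 1 - 1 / 4000 ≤ dist u V ∧ dist u V ≤ 1 + 1 / 4000)
    (hX : 1 - 1 / 4000 ≤ dist u X ∧ dist u X ≤ 1 + 1 / 4000)
    (hVX : 1 - 1 / 4000 ≤ dist V X ∧ dist V X ≤ 1 + 1 / 4000)
    (hY : 1 - 1 / 4000 ≤ dist u Y ∧ dist u Y ≤ 1 + 1 / 4000)
    (hVY : 1 - 1 / 4000 ≤ dist V Y ∧ dist V Y ≤ 1 + 1 / 4000)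
    (hD2 : D (u - V) (X - V) (Y - V) ≤ -0.77) : 2.6 ≤ dist X Y ^ 2 := by
  obtain ⟨⟨-, gx', Rx, Rx', Rx0⟩, ⟨Bx, -⟩, ⟨hA, hA', -, -⟩⟩ := rot_vpoint hF hV hX hVX
  obtain ⟨⟨gy, gy', Ry, Ry', Ry0⟩, ⟨By, -⟩, -⟩ := rot_vpoint hF hV hY hVY
  rw [dist_eq_norm, ← sub_sub_sub_cancel_right X Y V]
  have hg : ‖X - V - (Y - V)‖ ^ 2 = ‖X - V‖ ^ 2 + ‖Y - V‖ ^ 2 - 2 * ⟪X - V, Y - V⟫ := by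
    rw [norm_sub_sq_real (X - V) (Y - V)]
    ring
  obtain ⟨sx, sx'⟩ := rot_sqrtR Rx Rx'
  obtain ⟨sy, sy'⟩ := rot_sqrtR Ry Ry'
  obtain ⟨st, -⟩ := rot_prodR sx sx' sy sy'
  have hP : ‖u - V‖ ^ 2 * ⟪X - V, Y - V⟫ - ⟪u - V, X - V⟫ * ⟪u - V, Y - V⟫ =
      D (u - V) (X - V) (Y - V) * (√(R (u - V) (X - V)) * √(R (u - V) (Y - V))) :=
    (rotD_mul hF Rx0 Ry0).symm
  rw [hg]
  exact rot_chord_diag hA hA' Bx By gx' gy gy' st hP hD2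

/-- **A contact pair is never radial**: `T ≠ 0` for two contacts of `V` in contact. [folklore] -/
theorem rot_vT_ne_zero {u V X Y : EuclideanSpace ℝ (Fin 3)}
    (hV : 1 - 1 / 4000 ≤ dist u V ∧ dist u V ≤ 1 + 1 / 4000)
    (hX : 1 - 1 / 4000 ≤ dist u X ∧ dist u X ≤ 1 + 1 / 4000)
    (hVX : 1 - 1 / 4000 ≤ dist V X ∧ dist V X ≤ 1 + 1 / 4000)
    (hY : 1 - 1 / 4000 ≤ dist u Y ∧ dist u Y ≤ 1 + 1 / 4000)
    (hVY : 1 - 1 / 4000 ≤ dist V Y ∧ dist V Y ≤ 1 + 1 / 4000)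
    (hXY : 1 - 1 / 4000 ≤ dist X Y ∧ dist X Y ≤ 1 + 1 / 4000) :
    orient3 (u - V) (X - V) (Y - V) ≠ 0 := by
  obtain ⟨⟨-, -, -, -, Rx0⟩, -, -⟩ := rot_vpoint hF hV hX hVX
  obtain ⟨⟨-, -, -, -, Ry0⟩, -, -⟩ := rot_vpoint hF hV hY hVY
  obtain ⟨d1, d2⟩ := rot_vcontact hF hV hX hVX hY hVY hXY
  have hS0 := rotS_ne_zero hF Rx0 Ry0 d2 (by linarith)
  intro hT
  apply hS0
  rw [hF.2.2.2, hT, mul_zero, zero_div]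

omit hF in
/-- **A contact pair is never radial** (registered sub-goal `rot_contactNotRadial` of
`stub_localStructure`, one line): the closed form of `rot_vT_ne_zero`. [folklore] -/
theorem rot_contactNotRadial : ∀ (u V X Y : EuclideanSpace ℝ (Fin 3)), 1 - 1 / 4000 ≤ dist u V → dist u V ≤ 1 + 1 / 4000 → 1 - 1 / 4000 ≤ dist u X → dist u X ≤ 1 + 1 / 4000 → 1 - 1 / 4000 ≤ dist V X → dist V X ≤ 1 + 1 / 4000 → 1 - 1 / 4000 ≤ dist u Y → dist u Y ≤ 1 + 1 / 4000 → 1 - 1 / 4000 ≤ dist V Y → dist V Y ≤ 1 + 1 / 4000 → 1 - 1 / 4000 ≤ dist X Y → dist X Y ≤ 1 + 1 / 4000 → Literature.Geometry.DiscreteGeometry.orient3 (u - V) (X - V) (Y - V) ≠ 0 := by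
  intro u V X Y a1 a2 b1 b2 c1 c2 d1 d2 e1 e2 f1 f2
  obtain ⟨R, P, D, S, hF⟩ := rot_frame_exists
  exact rot_vT_ne_zero hF ⟨a1, a2⟩ ⟨b1, b2⟩ ⟨c1, c2⟩ ⟨d1, d2⟩ ⟨e1, e2⟩ ⟨f1, f2⟩

end Summit.AtomisticToContinuum.Crystallization.Theorems.ZeroDefectDensityBirth
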